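import Mathlib
import HarnessLib
import Literature.Analysis.FluidPDE.Tao2016AveragedNS.TaylorChainCertificate
import Summits.NavierStokesRegularity.NavierStokesRegularity.Theorems.TaylorModelRungThreeReadoutCoords

/-!
# Line `taylor-model` on crux K1b-DR (stmt-NavierStokesRegularity-23954) — read-out calculus for stub G4
# (`stub_landing : LandingC1`): the derivative of `σ ↦ ℓ (land j (ofVec (p σ)) v)` is `ℓ (landD j … (ofVec p'))`

Helper lemma requested by the G4 prover (ns-tm-g4 g0, pub-ns-dss INBOX 2026-08-28T02:46Z; split dss_16 (2)), exact
signature as typed there.  K1b-DR's landing clause differentiates `σ ↦ ℓ (nx j) l (land j (φ(y_σ, τ(y_σ))) v)`;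
once the landing point is a differentiable window-coordinate path `p : ℝ → (Fin (nW cd) → ℝ)` (G4's Poincaré-map
step), the remaining calculus is this file: for window-supported states the normalised landing map is
`land j y v = (Lv (nx j) / |y i₀ 1|) • (sh y + Y₀ v)` with the SHIFT `sh y i k := y i (1+k)` on `k + 1 ≤ Ka` and the
tail `Y₀ v i k := v i` beyond, so `x ↦ ℓ (sh (ofVec x))` and `x ↦ (ofVec x) i₀ 1` are ℝ-linear on the
finite-dimensional window coordinates — hence continuous linear (`LinearMap.toContinuousLinearMap`) and
differentiable — and the quotient/absolute-value rules (`hasDerivAt_abs`, `Real.sign = ↑(SignType.sign)`) give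
exactly the certificate module's explicit directional derivative `CertData.landD` (v2, p595623) read through `ℓ`.
No topology on the infinite product `Fin 4 → ℤ → ℝ` is used (`ℓ` is an arbitrary linear functional there).

MODEL-lattice bookkeeping only (rung TL-M3 of the NS ladder); nothing here is a statement about the Navier–Stokes
equations, and K1b-DR is not proved here.
-/

-- the sub-problem namespace repeats the summit name by design (D-0017)
set_option linter.dupNamespace false

namespace Summit.NavierStokesRegularity.NavierStokesRegularity.Theorems.TaylorModelReadout.G2

open Set Literature.Analysis.FluidPDE.TaoCascade Literature.Analysis.FluidPDE.TaoCascade.TaylorChain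

variable {cd : CertData}

/-- `Real.sign` agrees with the generic `SignType.sign` cast to `ℝ`. [folklore] -/
theorem real_sign_eq_sign_cast (r : ℝ) : Real.sign r = ((SignType.sign r : SignType) : ℝ) := by
  rcases lt_trichotomy r 0 with h | h | h
  · rw [Real.sign_of_neg h, sign_neg h, SignType.coe_neg_one]
  · subst h
    rw [Real.sign_zero, sign_zero, SignType.coe_zero]
  · rw [Real.sign_of_pos h, sign_pos h, SignType.coe_one]

/-- The shifted-window read-out `x ↦ ℓ n l (fun i k => (ofVec x) i (1+k) on k + 1 ≤ Ka, else 0)` is ℝ-linear on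
window coordinates. [folklore] -/
theorem isLinearMap_ell_shift (cd : CertData) (n l : ℕ) :
    IsLinearMap ℝ (fun x : Fin (nW cd) → ℝ =>
      cd.ℓ n l (fun i k => if k + 1 ≤ cd.Ka then ofVec cd x i (1 + k) else 0)) := by
  constructor
  · intro x x'
    rw [← map_add]
    congr 1
    funext i k
    simp only [Pi.add_apply, ofVec_add]
    split_ifs <;> simp
  · intro r x
    rw [← map_smul]
    congr 1
    funext i k
    simp only [Pi.smul_apply, smul_eq_mul, ofVec_smul]
    split_ifs <;> simp

/-- A window coordinate read through the zero extension `ofVec` is ℝ-linear. [folklore] -/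
theorem isLinearMap_ofVec_apply (cd : CertData) (i : Fin 4) (k : ℤ) :
    IsLinearMap ℝ (fun x : Fin (nW cd) → ℝ => ofVec cd x i k) :=
  ⟨fun x x' => by simp [ofVec_add], fun r x => by simp [ofVec_smul]⟩

/-- The normalised landing map of a state as `(Lv / |y i₀ 1|) • (shift + tail)`. [folklore] -/
theorem land_eq_smul (cd : CertData) (j : ℕ) (y : Fin 4 → ℤ → ℝ) (v : Fin 4 → ℝ) :
    cd.land j y v = (cd.Lv (cd.nx j) / |y cd.i₀ 1|) •
      ((fun i k => if k + 1 ≤ cd.Ka then y i (1 + k) else 0) + fun i k => if k + 1 ≤ cd.Ka then (0:ℝ) else v i) := by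
  funext i k
  simp only [CertData.land, Pi.smul_apply, Pi.add_apply, smul_eq_mul]
  split_ifs <;> ring

/-- The explicit directional derivative `landD` as a linear combination of the shift of the direction and the
shift + tail of the state. [folklore] -/
theorem landD_eq_smul (cd : CertData) (j : ℕ) (y : Fin 4 → ℤ → ℝ) (v : Fin 4 → ℝ) (z : Fin 4 → ℤ → ℝ) :
    cd.landD j y v z = cd.Lv (cd.nx j) •
      ((1 / |y cd.i₀ 1|) • (fun i k => if k + 1 ≤ cd.Ka then z i (1 + k) else 0) -
        (Real.sign (y cd.i₀ 1) * z cd.i₀ 1 / (y cd.i₀ 1) ^ 2) •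
          ((fun i k => if k + 1 ≤ cd.Ka then y i (1 + k) else 0) + fun i k => if k + 1 ≤ cd.Ka then (0:ℝ) else v i)) := by
  funext i k
  simp only [CertData.landD, Pi.smul_apply, Pi.add_apply, Pi.sub_apply, smul_eq_mul]
  split_ifs <;> ring

/-- **Read-out calculus (for stub G4, exact signature requested by ns-tm-g4).** Along a window-coordinate path
`p` with derivative `p'` within `s` at `σ`, at a point where the normalising coordinate `(ofVec (p σ)) i₀ 1` is
non-zero, the landing read-out `σ' ↦ ℓ n l (land j (ofVec (p σ')) v)` has derivative
`ℓ n l (landD j (ofVec (p σ)) v (ofVec p'))` within `s` at `σ`. [folklore] -/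
theorem hasDerivWithinAt_ell_land (cd : CertData) (j n l : ℕ) (v : Fin 4 → ℝ) {p : ℝ → (Fin (nW cd) → ℝ)}
    {p' : Fin (nW cd) → ℝ} {s : Set ℝ} {σ : ℝ} (hp : HasDerivWithinAt p p' s σ)
    (h0 : ofVec cd (p σ) cd.i₀ 1 ≠ 0) :
    HasDerivWithinAt (fun σ' => cd.ℓ n l (cd.land j (ofVec cd (p σ')) v))
      (cd.ℓ n l (cd.landD j (ofVec cd (p σ)) v (ofVec cd p'))) s σ := by
  -- the two linear read-outs as continuous linear maps on the window coordinates
  obtain ⟨A, hA⟩ : ∃ A : (Fin (nW cd) → ℝ) →L[ℝ] ℝ,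
      ∀ x, A x = cd.ℓ n l (fun i k => if k + 1 ≤ cd.Ka then ofVec cd x i (1 + k) else 0) :=
    ⟨LinearMap.toContinuousLinearMap (IsLinearMap.mk' _ (isLinearMap_ell_shift cd n l)), fun _ => rfl⟩
  obtain ⟨B, hB⟩ : ∃ B : (Fin (nW cd) → ℝ) →L[ℝ] ℝ, ∀ x, B x = ofVec cd x cd.i₀ 1 :=
    ⟨LinearMap.toContinuousLinearMap (IsLinearMap.mk' _ (isLinearMap_ofVec_apply cd cd.i₀ 1)), fun _ => rfl⟩
  set c : ℝ := cd.ℓ n l (fun i k => if k + 1 ≤ cd.Ka then (0:ℝ) else v i) with hc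
  -- the read-out as an explicit quotient
  have hg : ∀ x, cd.ℓ n l (cd.land j (ofVec cd x) v) = cd.Lv (cd.nx j) * ((A x + c) / |B x|) := by
    intro x
    rw [land_eq_smul, map_smul, map_add, smul_eq_mul, hA, hB]
    ring
  have hB0 : B (p σ) ≠ 0 := by rw [hB]; exact h0
  have hAp : HasDerivWithinAt (fun σ' => A (p σ') + c) (A p') s σ :=
    (A.hasFDerivAt.comp_hasDerivWithinAt σ hp).add_const c
  have hBp : HasDerivWithinAt (fun σ' => B (p σ')) (B p') s σ := B.hasFDerivAt.comp_hasDerivWithinAt σ hp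
  have habs : HasDerivWithinAt (fun σ' => |B (p σ')|) (Real.sign (B (p σ)) * B p') s σ := by
    have h := (hasDerivAt_abs hB0).comp_hasDerivWithinAt σ hBp
    rw [← real_sign_eq_sign_cast] at h
    exact h
  have hquot := ((hAp.div habs (abs_ne_zero.2 hB0)).const_mul (cd.Lv (cd.nx j)))
  have hfun : (fun σ' => cd.ℓ n l (cd.land j (ofVec cd (p σ')) v)) =
      fun σ' => cd.Lv (cd.nx j) * ((fun σ'' => A (p σ'') + c) σ' / (fun σ'' => |B (p σ'')|) σ') := by
    funext σ'
    exact hg (p σ')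
  have hval : cd.ℓ n l (cd.landD j (ofVec cd (p σ)) v (ofVec cd p')) =
      cd.Lv (cd.nx j) * ((A p' * |B (p σ)| - (A (p σ) + c) * (Real.sign (B (p σ)) * B p')) / |B (p σ)| ^ 2) := by
    rw [landD_eq_smul, map_smul, map_sub, map_smul, map_smul, map_add, ← hA, ← hA, ← hB, ← hB, smul_eq_mul,
      smul_eq_mul, smul_eq_mul]
    have hb : |B (p σ)| ≠ 0 := abs_ne_zero.2 hB0
    rw [← sq_abs (B (p σ))]
    field_simp
    ring
  rw [hfun, hval]
  exact hquot

end Summit.NavierStokesRegularity.NavierStokesRegularity.Theorems.TaylorModelReadout.G2
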